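import Summits.BirchSwinnertonDyer.BirchSwinnertonDyer.Theorems.PrintX11aGL1CartanDefs
import Summits.BirchSwinnertonDyer.Rank1Residual.X11a.PrintDischargeEulerHalf
import Summits.BirchSwinnertonDyer.Rank1Residual.GaloisImage.InertiaRootableNonsplitMultiplicative
import Summits.BirchSwinnertonDyer.Rank1Residual.X11b.KummerRelaxedStructures
import Summits.BirchSwinnertonDyer.Rank1Residual.Additive.CyclotomicThreeMultiplicativeReduction
import Literature.NumberTheory.GaloisRepresentations.BlochKatoSelmerGroup
import Literature.NumberTheory.GaloisRepresentations.ContinuousH1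
import Literature.NumberTheory.GaloisRepresentations.UnramifiedSubgroupMapSurjective
import Literature.NumberTheory.GaloisRepresentations.GaloisH1MapBijectiveUnramified
import Literature.NumberTheory.GaloisRepresentations.DecompositionGroupOfCompletion
import Literature.NumberTheory.EllipticCurves.GreenbergSelmer
import Literature.NumberTheory.EllipticCurves.GaloisAction
import Literature.NumberTheory.EllipticCurves.HeegnerPoints
import Literature.NumberTheory.EllipticCurves.HeegnerPointsKolyvaginSelmerProofs
import Literature.NumberTheory.EllipticCurves.Tamagawa
import Literature.NumberTheory.EllipticCurves.SelmerTorsionRestriction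
import Literature.NumberTheory.EllipticCurves.KummerSelmerStructure
import Literature.NumberTheory.EllipticCurves.TorsionLocalKernelRestrictionProofs
import Literature.NumberTheory.EllipticCurves.LocalTorsionCohomologyCoprime
import Literature.NumberTheory.EllipticCurves.LocalTorsionAwayFromResidueCharProofs
import Literature.NumberTheory.EllipticCurves.SemistableModPImageMultiplicativeProofs
import Literature.NumberTheory.EllipticCurves.ZpExtensionInertiaTorsionCyclotomicProofs
import Literature.NumberTheory.EllipticCurves.SerreOpenImageDeterminantProofs
import Literature.NumberTheory.EllipticCurves.SerreOpenImageOrdinaryInertiaProofs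
import Literature.NumberTheory.EllipticCurves.PotentiallyGoodOrdinaryReductionAtTwoProofs
import Literature.NumberTheory.EllipticCurves.CasselsTateSelmerKolyvaginValue
import Literature.NumberTheory.EllipticCurves.AnticyclotomicInertiaAboveP
import Literature.NumberTheory.EllipticCurves.TamagawaPrimesEquivProofs
import Literature.NumberTheory.EllipticCurves.LFunctionPrimeCoeff
import Literature.NumberTheory.SerreUniformity.SplitCartan
import Literature.NumberTheory.DiophantineGeometry.LocalReduction
import HarnessLib

/-!
# Line «gl1cartan5» of crux U5 `Theses.PrintX11a.UpperNonSurjFive` — stub D (Cartan descent), part 1/3: the projection `π_*`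

For a Cartan descent datum `𝒟 : CartanDatum W p` (`Theorems/PrintX11aGL1CartanDefs.lean`) and a `Γ_K`-stable complement `L'` of
the line `ι(M) ⊂ E_K[p]` (supplied by D-G, `stub_cartanGlobal`), this file builds the equivariant projection `π : E_K[p] → M` along
`L'` (§1–§2), the push-forward `π_* : H¹(K, E_K[p]) → H¹(K, M)` with its kernel criterion «`π_* c = 0` iff `c` has an `L'`-valued
representative» (§3), and the compatibility of `π_*` with localisation at a place (§4).  Parts 2/3 (local conditions) and 3/3 (the
assembly `stub_cartanDescent`) import it.  Lead `cruxlead-stmt-BirchSwinnertonDyer-20614` g0, cell `bsd-print-x11a`.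

BSD is not proved by any of this; nothing is asserted about any particular curve; no statement of the summit is proved here.

References: [MazurRubin2004] Def. 2.1.1; [Serre1972] §1.12, §2.8; [SerreGaloisCohomology1997] I.§2, I.§5; [SilvermanAEC2009] X.4.2,
Cor. X.4.4, VII.6; [SilvermanATAEC1994] V.3.1, V.5.2–5.4; [GrossLMS1991] §5 (5.1); [MilneADT2006] I.3.8.
-/


-- justified: the file namespace `Summit.BirchSwinnertonDyer.BirchSwinnertonDyer.Theorems.GL1Cartan` repeats the sub-problem segment by the D-0017 layout
set_option linter.dupNamespace false
set_option autoImplicit false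

noncomputable section

open scoped Classical NumberField ContRepresentation

open WeierstrassCurve Field IsDedekindDomain NumberField
  Literature.NumberTheory.EllipticCurves
  Literature.NumberTheory.EllipticCurves.Rank1Residual
  Literature.NumberTheory.EllipticCurves.Rank1Residual.Typed
  Literature.NumberTheory.GaloisRepresentations
  Literature.NumberTheory.GaloisRepresentations.DiscreteGaloisModule
  Literature.NumberTheory.SerreUniformity
  Summit.BirchSwinnertonDyer.Rank1Residual

namespace Summit.BirchSwinnertonDyer.BirchSwinnertonDyer.Theorems.GL1Cartan


/-! ## §1 Preliminaries: the line `ι(M)`, cardinalities, direct-sum decompositions -/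

section Prelim

variable {W : WeierstrassCurve ℚ} [W.IsElliptic] {p : ℕ} [Fact p.Prime]

namespace CartanDatum

/-- The line `L = ι(M) ≤ E_K[p](K̄)` of a Cartan descent datum. [folklore] -/
def line (𝒟 : CartanDatum W p) : AddSubgroup ((W.baseChange 𝒟.K).geomTorsion (p : ℤ)) :=
  𝒟.ι.range

/-- `#L = p`. [folklore] -/
theorem natCard_line (𝒟 : CartanDatum W p) : Nat.card 𝒟.line = p :=
  (Nat.card_congr (AddMonoidHom.ofInjective 𝒟.injective).toEquiv).symm.trans 𝒟.card

/-- `L` is `Γ_K`-stable. [folklore] -/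
theorem smul_mem_line (𝒟 : CartanDatum W p) (σ : absoluteGaloisGroup 𝒟.K)
    (P : (W.baseChange 𝒟.K).geomTorsion (p : ℤ)) (hP : P ∈ 𝒟.line) : σ • P ∈ 𝒟.line := by
  obtain ⟨m, rfl⟩ := hP
  exact ⟨𝒟.ρ σ m, 𝒟.equivariant σ m⟩

/-- `[K : ℚ] = 2`. [folklore] -/
theorem finrank_eq_two (𝒟 : CartanDatum W p) : Module.finrank ℚ 𝒟.K = 2 :=
  𝒟.imaginaryQuadratic.1

end CartanDatum

/-- `#E_K[p] = p²`. [cite: SilvermanAEC2009, Cor. III.6.4 (b)] -/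
theorem natCard_geomTorsion_baseChange (K : Type) [Field K] [NumberField K] :
    Nat.card ((W.baseChange K).geomTorsion (p : ℤ)) = p ^ 2 := by
  haveI : (W.baseChange K).IsElliptic := by rw [baseChange]; infer_instance
  have hp : (p : ℤ) ≠ 0 := by exact_mod_cast (Fact.out : p.Prime).ne_zero
  rw [WeierstrassCurve.natCard_geomTorsion (W.baseChange K) (p : ℤ) hp, Int.natAbs_natCast]

/-- The addition map `L × L' → G`. [folklore] -/
def sumHom {G : Type*} [AddCommGroup G] (L L' : AddSubgroup G) : L × L' →+ G :=
  L.subtype.coprod L'.subtype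

omit [Fact p.Prime] in
/-- `sumHom (a, b) = a + b`. [folklore] -/
@[simp] theorem sumHom_apply {G : Type*} [AddCommGroup G] (L L' : AddSubgroup G) (x : L × L') :
    sumHom L L' x = (x.1 : G) + x.2 := rfl

omit [Fact p.Prime] in
/-- `L ⊓ L' = ⊥` makes the addition map injective. [folklore] -/
theorem sumHom_injective {G : Type*} [AddCommGroup G] {L L' : AddSubgroup G} (h : L ⊓ L' = ⊥) :
    Function.Injective (sumHom L L') := by
  intro x y hxy
  simp only [sumHom_apply] at hxy
  have h1 : (x.1 : G) - y.1 = y.2 - x.2 := by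
    rw [sub_eq_sub_iff_add_eq_add, hxy, add_comm]
  have hmem : (x.1 : G) - y.1 ∈ L ⊓ L' :=
    ⟨L.sub_mem x.1.2 y.1.2, by rw [h1]; exact L'.sub_mem y.2.2 x.2.2⟩
  rw [h] at hmem
  have h0 : (x.1 : G) - y.1 = 0 := hmem
  have h0' : (y.2 : G) - x.2 = 0 := by rw [← h1, h0]
  ext
  · exact sub_eq_zero.mp h0
  · exact (sub_eq_zero.mp h0').symm

/-- Two subgroups of order `p` of a group of order `p²` with trivial intersection: the addition map
`L × L' → G` is bijective. [folklore] -/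
theorem sumHom_bijective {G : Type*} [AddCommGroup G] {L L' : AddSubgroup G}
    (hG : Nat.card G = p ^ 2) (hL : Nat.card L = p) (hL' : Nat.card L' = p) (h : L ⊓ L' = ⊥) :
    Function.Bijective (sumHom L L') := by
  have hp : p.Prime := Fact.out
  haveI : Finite G := Nat.finite_of_card_ne_zero (by rw [hG]; exact pow_ne_zero _ hp.ne_zero)
  letI : Fintype G := Fintype.ofFinite G
  letI : Fintype L := Fintype.ofFinite L
  letI : Fintype L' := Fintype.ofFinite L'
  refine (Fintype.bijective_iff_injective_and_card _).mpr ⟨sumHom_injective h, ?_⟩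
  rw [Fintype.card_prod, ← Nat.card_eq_fintype_card, ← Nat.card_eq_fintype_card,
    ← Nat.card_eq_fintype_card, hL, hL', hG, sq]

/-- The decomposition `G ≃ L × L'`. [folklore] -/
def decomp {G : Type*} [AddCommGroup G] {L L' : AddSubgroup G}
    (hG : Nat.card G = p ^ 2) (hL : Nat.card L = p) (hL' : Nat.card L' = p) (h : L ⊓ L' = ⊥) :
    G ≃+ L × L' :=
  (AddEquiv.ofBijective (sumHom L L') (sumHom_bijective (p := p) hG hL hL' h)).symm

/-- The projection `G → L` along `L'`. [folklore] -/
def projFst {G : Type*} [AddCommGroup G] {L L' : AddSubgroup G}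
    (hG : Nat.card G = p ^ 2) (hL : Nat.card L = p) (hL' : Nat.card L' = p) (h : L ⊓ L' = ⊥) :
    G →+ L :=
  (AddMonoidHom.fst L L').comp (decomp (p := p) hG hL hL' h).toAddMonoidHom

/-- `decomp (a + b) = (a, b)`. [folklore] -/
theorem decomp_add {G : Type*} [AddCommGroup G] {L L' : AddSubgroup G}
    (hG : Nat.card G = p ^ 2) (hL : Nat.card L = p) (hL' : Nat.card L' = p) (h : L ⊓ L' = ⊥)
    (a : L) (b : L') : decomp (p := p) hG hL hL' h ((a : G) + b) = (a, b) := by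
  apply (decomp (p := p) hG hL hL' h).symm.injective
  rw [AddEquiv.symm_apply_apply]
  rfl

/-- The projection is the identity on `L`, zero on `L'`. [folklore] -/
theorem projFst_apply_add {G : Type*} [AddCommGroup G] {L L' : AddSubgroup G}
    (hG : Nat.card G = p ^ 2) (hL : Nat.card L = p) (hL' : Nat.card L' = p) (h : L ⊓ L' = ⊥)
    (a : L) (b : L') : projFst (p := p) hG hL hL' h ((a : G) + b) = a := by
  change (decomp (p := p) hG hL hL' h ((a : G) + b)).1 = a
  rw [decomp_add]

/-- Every element is `a + b`. [folklore] -/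
theorem exists_eq_add {G : Type*} [AddCommGroup G] {L L' : AddSubgroup G}
    (hG : Nat.card G = p ^ 2) (hL : Nat.card L = p) (hL' : Nat.card L' = p) (h : L ⊓ L' = ⊥)
    (P : G) : ∃ (a : L) (b : L'), P = (a : G) + b := by
  obtain ⟨⟨a, b⟩, hab⟩ := (sumHom_bijective (p := p) hG hL hL' h).2 P
  exact ⟨a, b, hab.symm⟩

end Prelim

/-! ## §2 The equivariant projection `π : E_K[p] → M` along a complement and `π_*` on `H¹` -/

section Projection

variable {W : WeierstrassCurve ℚ} [W.IsElliptic] {p : ℕ} [Fact p.Prime] (𝒟 : CartanDatum W p)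
  (L' : AddSubgroup ((W.baseChange 𝒟.K).geomTorsion (p : ℤ)))
  (hL'card : Nat.card L' = p) (hLL' : 𝒟.line ⊓ L' = ⊥)

namespace CartanDatum

/-- `ι : M ≃ L`. [folklore] -/
def ιEquiv : 𝒟.M ≃+ 𝒟.line :=
  AddMonoidHom.ofInjective 𝒟.injective

/-- `ι (ιEquiv⁻¹ a) = a`. [folklore] -/
@[simp] theorem ι_ιEquiv_symm (a : 𝒟.line) : 𝒟.ι (𝒟.ιEquiv.symm a) = a :=
  AddMonoidHom.apply_ofInjective_symm 𝒟.injective a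

/-- `ιEquiv⁻¹ (ι m) = m`. [folklore] -/
@[simp] theorem ιEquiv_symm_ι (m : 𝒟.M) : 𝒟.ιEquiv.symm ⟨𝒟.ι m, ⟨m, rfl⟩⟩ = m :=
  𝒟.injective (by rw [ι_ιEquiv_symm])

/-- **The projection `π : E_K[p] → M` along the complement `L'`.** [folklore] -/
def proj : (W.baseChange 𝒟.K).geomTorsion (p : ℤ) →+ 𝒟.M :=
  𝒟.ιEquiv.symm.toAddMonoidHom.comp
    (projFst (p := p) (natCard_geomTorsion_baseChange 𝒟.K) 𝒟.natCard_line hL'card hLL')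

/-- `π (a + b) = ι⁻¹ a` for `a ∈ L`, `b ∈ L'`. [folklore] -/
theorem proj_add (a : 𝒟.line) (b : L') :
    𝒟.proj L' hL'card hLL' ((a : (W.baseChange 𝒟.K).geomTorsion (p : ℤ)) + b) = 𝒟.ιEquiv.symm a := by
  change 𝒟.ιEquiv.symm (projFst (p := p) _ _ hL'card hLL' ((a : (W.baseChange 𝒟.K).geomTorsion (p : ℤ)) + b)) = _
  rw [projFst_apply_add]

/-- `π ∘ ι = id`. [folklore] -/
@[simp] theorem proj_ι (m : 𝒟.M) : 𝒟.proj L' hL'card hLL' (𝒟.ι m) = m := by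
  have h := 𝒟.proj_add L' hL'card hLL' ⟨𝒟.ι m, ⟨m, rfl⟩⟩ (0 : L')
  rw [ZeroMemClass.coe_zero, add_zero] at h
  rw [h, ιEquiv_symm_ι]

/-- `π` vanishes on `L'`. [folklore] -/
theorem proj_eq_zero_of_mem {P : (W.baseChange 𝒟.K).geomTorsion (p : ℤ)} (hP : P ∈ L') :
    𝒟.proj L' hL'card hLL' P = 0 := by
  have h := 𝒟.proj_add L' hL'card hLL' (0 : 𝒟.line) ⟨P, hP⟩
  rw [ZeroMemClass.coe_zero, zero_add] at h
  rw [h, map_zero]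

/-- `ker π = L'`. [folklore] -/
theorem mem_of_proj_eq_zero {P : (W.baseChange 𝒟.K).geomTorsion (p : ℤ)}
    (hP : 𝒟.proj L' hL'card hLL' P = 0) : P ∈ L' := by
  obtain ⟨a, b, rfl⟩ := exists_eq_add (p := p) (natCard_geomTorsion_baseChange 𝒟.K) 𝒟.natCard_line hL'card hLL' P
  rw [proj_add] at hP
  have ha : (a : (W.baseChange 𝒟.K).geomTorsion (p : ℤ)) = 0 := by
    rw [← 𝒟.ι_ιEquiv_symm a, hP, map_zero]
  rw [ha, zero_add]
  exact b.2

variable (hL'stab : ∀ (σ : absoluteGaloisGroup 𝒟.K) (P : (W.baseChange 𝒟.K).geomTorsion (p : ℤ)),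
  P ∈ L' → σ • P ∈ L')

include hL'stab

/-- **`π` is `Γ_K`-equivariant**: `π (σ • P) = ρ σ (π P)`. [folklore] -/
theorem proj_smul (σ : absoluteGaloisGroup 𝒟.K) (P : (W.baseChange 𝒟.K).geomTorsion (p : ℤ)) :
    𝒟.proj L' hL'card hLL' (σ • P) = 𝒟.ρ σ (𝒟.proj L' hL'card hLL' P) := by
  obtain ⟨a, b, rfl⟩ := exists_eq_add (p := p) (natCard_geomTorsion_baseChange 𝒟.K) 𝒟.natCard_line hL'card hLL' P
  have ha : σ • (a : (W.baseChange 𝒟.K).geomTorsion (p : ℤ)) ∈ 𝒟.line := 𝒟.smul_mem_line σ a a.2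
  have hb : σ • (b : (W.baseChange 𝒟.K).geomTorsion (p : ℤ)) ∈ L' := hL'stab σ b b.2
  rw [smul_add, show σ • (a : (W.baseChange 𝒟.K).geomTorsion (p : ℤ)) + σ • (b : _) =
      ((⟨σ • (a : _), ha⟩ : 𝒟.line) : (W.baseChange 𝒟.K).geomTorsion (p : ℤ)) + ((⟨σ • (b : _), hb⟩ : L') : _)
      from rfl, proj_add, proj_add]
  apply 𝒟.injective
  rw [ι_ιEquiv_symm, 𝒟.equivariant, ι_ιEquiv_symm]

/-- `π` as a continuous intertwining map `E_K[p] → M` of discrete Galois modules. [folklore] -/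
def projI : ((W.baseChange 𝒟.K).torsionGaloisModule (p : ℤ)).toContRepresentation →ⁱL
    𝒟.ρ.toContRepresentation where
  toContinuousLinearMap := ⟨(𝒟.proj L' hL'card hLL').toIntLinearMap, continuous_of_discreteTopology⟩
  isIntertwining' σ := by
    ext P
    exact 𝒟.proj_smul L' hL'card hLL' hL'stab σ P

end CartanDatum

end Projection

/-! ## §3 `π_*` on `H¹` and its kernel: classes with an `L'`-valued representative -/

section PushForward

variable {W : WeierstrassCurve ℚ} [W.IsElliptic] {p : ℕ} [Fact p.Prime] (𝒟 : CartanDatum W p)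
  (L' : AddSubgroup ((W.baseChange 𝒟.K).geomTorsion (p : ℤ)))
  (hL'card : Nat.card L' = p) (hLL' : 𝒟.line ⊓ L' = ⊥)
  (hL'stab : ∀ (σ : absoluteGaloisGroup 𝒟.K) (P : (W.baseChange 𝒟.K).geomTorsion (p : ℤ)),
    P ∈ L' → σ • P ∈ L')

namespace CartanDatum

/-- **`π_* : H¹(K, E_K[p]) → H¹(K, M)`** (change of coefficients along the equivariant projection).
[cite: SerreGaloisCohomology1997, I.§2.2] -/
def projH1 : galH1Torsion (W.baseChange 𝒟.K) (p : ℤ) →+ galoisCohomology 𝒟.ρ 1 :=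
  galoisCohomology.map (𝒟.projI L' hL'card hLL' hL'stab) 1

/-- The principal cocycle `g ↦ g • P − P` of `E_K[p]`. [cite: SerreGaloisCohomology1997, I.§5.1] -/
def principalCocycle (P : (W.baseChange 𝒟.K).geomTorsion (p : ℤ)) :
    contOneCocycles (discreteTopRep (absoluteGaloisGroup 𝒟.K) ((W.baseChange 𝒟.K).geomTorsion (p : ℤ))) :=
  ⟨⟨fun g => g • P - P,
    (continuous_smul_of_isOpen_stabilizer P
      ((W.baseChange 𝒟.K).isOpen_stabilizer_geomTorsion (p : ℤ) P)).sub continuous_const⟩,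
    fun g h => by
      change (g * h) • P - P = (g • P - P) + g • (h • P - P)
      rw [mul_smul, smul_sub]
      abel⟩

/-- Values of the principal cocycle. [folklore] -/
@[simp] theorem principalCocycle_apply (P : (W.baseChange 𝒟.K).geomTorsion (p : ℤ))
    (g : absoluteGaloisGroup 𝒟.K) : (𝒟.principalCocycle P).1 g = g • P - P := rfl

/-- The principal cocycle is a coboundary. [cite: SerreGaloisCohomology1997, I.§5.1] -/
theorem oneCocycleClass_principalCocycle (P : (W.baseChange 𝒟.K).geomTorsion (p : ℤ)) :
    oneCocycleClass _ (𝒟.principalCocycle P) = 0 :=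
  (oneCocycleClass_eq_zero_iff _ _).mpr ⟨P, fun _ => rfl⟩

/-- **Kernel criterion.** A class killed by `π_*` has an `L'`-VALUED representative: if `π ∘ φ = ∂m` then
`φ − ∂(ι m)` is `L'`-valued (`ker π = L'`) and cohomologous to `φ`. [cite: SerreGaloisCohomology1997, I.§5.1] -/
theorem exists_valued_of_projH1_eq_zero (c : galH1Torsion (W.baseChange 𝒟.K) (p : ℤ))
    (hc : 𝒟.projH1 L' hL'card hLL' hL'stab c = 0) :
    ∃ φ : contOneCocycles (discreteTopRep (absoluteGaloisGroup 𝒟.K) ((W.baseChange 𝒟.K).geomTorsion (p : ℤ))),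
      (∀ g, φ.1 g ∈ L') ∧ oneCocycleClass _ φ = c := by
  obtain ⟨φ, rfl⟩ := oneCocycleClass_surjective
    (discreteTopRep (absoluteGaloisGroup 𝒟.K) ((W.baseChange 𝒟.K).geomTorsion (p : ℤ))) c
  change galoisCohomology.map (𝒟.projI L' hL'card hLL' hL'stab) 1 (oneCocycleClass _ φ) = 0 at hc
  rw [galoisCohomology.map_one_oneCocycleClass] at hc
  obtain ⟨m, hm⟩ := (oneCocycleClass_eq_zero_iff _ _).mp hc
  refine ⟨φ - 𝒟.principalCocycle (𝒟.ι m), fun g => ?_, ?_⟩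
  · apply 𝒟.mem_of_proj_eq_zero L' hL'card hLL'
    have h : 𝒟.proj L' hL'card hLL' (φ.1 g) = 𝒟.ρ g m - m := hm g
    change 𝒟.proj L' hL'card hLL' (φ.1 g - (g • 𝒟.ι m - 𝒟.ι m)) = 0
    rw [map_sub, map_sub, h, 𝒟.proj_smul L' hL'card hLL' hL'stab, proj_ι, sub_self]
  · rw [oneCocycleClass_sub, oneCocycleClass_principalCocycle, sub_zero]

end CartanDatum

end PushForward

/-! ## §4 Localisation commutes with `π_*` -/

section Localization

variable {W : WeierstrassCurve ℚ} [W.IsElliptic] {p : ℕ} [Fact p.Prime] (𝒟 : CartanDatum W p)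
  (L' : AddSubgroup ((W.baseChange 𝒟.K).geomTorsion (p : ℤ)))
  (hL'card : Nat.card L' = p) (hLL' : 𝒟.line ⊓ L' = ⊥)
  (hL'stab : ∀ (σ : absoluteGaloisGroup 𝒟.K) (P : (W.baseChange 𝒟.K).geomTorsion (p : ℤ)),
    P ∈ L' → σ • P ∈ L')

namespace CartanDatum

/-- **`loc_v ∘ π_* = (π|_{Γ_{K_v}})_* ∘ loc_v`** at every place `v` of `K`.
[cite: SerreGaloisCohomology1997, I.§2.4] -/
theorem res_projH1 (E : Type) [Field E] [Algebra 𝒟.K E] (c : galH1Torsion (W.baseChange 𝒟.K) (p : ℤ)) :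
    galoisCohomology.res 𝒟.ρ E 1 (𝒟.projH1 L' hL'card hLL' hL'stab c) =
      galoisCohomology.map ((𝒟.projI L' hL'card hLL' hL'stab).restrictField E) 1
        (galoisCohomology.res ((W.baseChange 𝒟.K).torsionGaloisModule (p : ℤ)) E 1 c) :=
  galoisCohomology.res_map_one E (𝒟.projI L' hL'card hLL' hL'stab) c

/-- At a place `v`, the image under `(π|_{Γ_{K_v}})_*` of the class of a cocycle `ψ` on `Γ_{K_v}` is the class
of `π ∘ ψ`; in particular it VANISHES when `ψ` is `L'`-valued. [cite: SerreGaloisCohomology1997, I.§2.2] -/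
theorem map_restrictField_projI_oneCocycleClass_eq_zero (E : Type) [Field E] [Algebra 𝒟.K E]
    (ψ : contOneCocycles
      ((GaloisRep.restrictField E ((W.baseChange 𝒟.K).torsionGaloisModule (p : ℤ))).toTopRep))
    (hψ : ∀ g, (ψ.1 g : (W.baseChange 𝒟.K).geomTorsion (p : ℤ)) ∈ L') :
    galoisCohomology.map ((𝒟.projI L' hL'card hLL' hL'stab).restrictField E) 1
      (oneCocycleClass _ ψ) = 0 := by
  rw [galoisCohomology.map_one_oneCocycleClass]
  refine (oneCocycleClass_eq_zero_iff _ _).mpr ⟨0, fun g => ?_⟩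
  rw [map_zero, sub_zero]
  exact 𝒟.proj_eq_zero_of_mem L' hL'card hLL' (hψ g)

end CartanDatum

end Localization

end Summit.BirchSwinnertonDyer.BirchSwinnertonDyer.Theorems.GL1Cartan

end
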